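import Summits.CriticalPhenomena.PercolationContinuityZ3.Theorems.PercNearOneGluingNoHeavyLowerTailCILEdgeRaising
import Summits.CriticalPhenomena.PercolationContinuityZ3.Theorems.PercNearOneGluingNoHeavyLowerTailCILReduction
import HarnessLib

/-!
# `NoHeavyLowerTail` (stmt-CriticalPhenomena-4575) — the induction on positive pairs: the champion-shift condition (ML)
# implies set-champion stability, the cumulative isolation lemma, and the crux

Support file (prover `prim-gen-induct`; `--supports stmt-CriticalPhenomena-4575`).  No definitions, no named facts, no sorries.

Notation (`μ_w = prodBernoulli w` on `Fin n`, relays `A`, level `j`, `π(x)`, `π(S)` as in `…CILPeeling`):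
* `I_w(x) = μ_w{|π(x)| ≤ j}` (lightness), a CHAMPION is a relay `c ∈ A` maximising `I_w` over `A`;
* `CS_w(S, c) : μ_w(c ↮ S, 1 ≤ |π(S)| ≤ j) ≤ μ_w(c ↮ S, |π(c)| ≤ j)` (set-champion stability);
* `J_w(S, x) = μ_w(x ↮ S, |π(x)| ≤ j) + μ_w(x ↔ S, |π(S)| ≤ j)` — the lightness of `x` in the graph with `S` glued to one
  vertex, written without gluing (`bad_le_glued_iff_setCS`: for `c ∈ A`, `CS_w(S,c) ⇔ μ_w{1 ≤ |π(S)| ≤ j} ≤ J_w(S,c)`;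
  `glued_singleton`: `J_w({v}, x) = I_w(x)`).

THE CHAMPION-SHIFT CONDITION (ML) (hypothesis `hML` below; crux notes BLOBQUOTIENT.md §10): for every weighted graph, every
set `S` of at least two non-relays all LIGHTER than a champion `c` (`I_w(c) < I_w(v)`, `v ∈ S`) and joined to the rest by a
positive pair, there are a nonempty set `F` of positive pairs at `S` and a champion `c_F` of the graph `w^F` with `F`
switched off such that `J_w(S, c_F) ≤ J_w(S, c)`.

* `setCS_of_ML` — **(ML) ⇒ set-champion stability for every weighted graph, every set `S` of non-relays and every
  champion** (the sibling line's conjecture CS, whose two-point case is the registered `stub_championStabilityPair`).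
  Proof: induction on the number of positive pairs.  A set with a member no lighter than `c` is the lonely-cluster exchange
  (`observerSet_le_of_lonelier`); a set with no positive pair leaving it carries no mass (`setCS_of_isolated`); otherwise
  take `F, c_F` from (ML) (for `|S| = 1`: all positive pairs at `S` and any champion of `w^F`, using `J_w({v},·) = I_w`),
  get `CS_w(T, c_F)` for all `T ⊇ S` by EDGE RAISING (`setCS_of_subgraph`) from the induction hypothesis for `w^F`
  (non-relay `T`) and the lonely-cluster exchange (relay-containing `T`), and shift the witness from `c_F` to `c` through
  `J_w(S, c_F) ≤ J_w(S, c)`.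
* `cumulativeIsolation_of_ML`, `noHeavyLowerTail_of_ML` — hence the registered stub `stub_cumulativeIsolation` (all levels,
  all `|A|`) and the crux `NoHeavyLowerTail` (`Theorems.noHeavyLowerTail_of_stub_cumulativeIsolation`).

So the crux is reduced to (ML), a comparison of LIGHTNESS CHAMPIONS of three nested graphs (`w^F ≤ w ≤ w` glued at `S`)
that involves no observer event; it is automatic for `|S| = 1` and for adjacent pairs, has no failure in the exact census
for light sets, and is false for non-light sets (which need no (ML)).
-/

noncomputable section

namespace Summit.CriticalPhenomena.PercolationContinuityZ3.Theorems

open MeasureTheory Set Literature.Probability.LatticeModels Literature.Probability.Percolation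
open scoped Classical BigOperators

variable {n : ℕ}

namespace CutObserver

/-- `CS_w(S, c)` versus the glued form: for `c ∈ A`,
`μ_w(c ↮ S, 1 ≤ |π(S)| ≤ j) ≤ μ_w(c ↮ S, |π(c)| ≤ j)` iff `μ_w{1 ≤ |π(S)| ≤ j} ≤ J_w(S, c)`, because on `{c ↔ S}` one has
`c ∈ π(S)` and the two sides differ by the same mass `μ_w(c ↔ S, |π(S)| ≤ j)`. [folklore] -/
theorem bad_le_glued_iff_setCS (w : Sym2 (Fin n) → unitInterval) (A S : Finset (Fin n)) (c : Fin n) (j : ℕ)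
    (hcA : c ∈ A) :
    (prodBernoulli w).real {ω : BondConfig (Fin n) | (∀ x ∈ S, ω ∉ openConn c x) ∧
        1 ≤ (A.filter fun z => ∃ x ∈ S, ω ∈ openConn x z).card ∧
        (A.filter fun z => ∃ x ∈ S, ω ∈ openConn x z).card ≤ j} ≤
      (prodBernoulli w).real {ω : BondConfig (Fin n) | (∀ x ∈ S, ω ∉ openConn c x) ∧
        (A.filter fun z => ω ∈ openConn c z).card ≤ j} ↔
    (prodBernoulli w).real {ω : BondConfig (Fin n) |
        1 ≤ (A.filter fun z => ∃ x ∈ S, ω ∈ openConn x z).card ∧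
        (A.filter fun z => ∃ x ∈ S, ω ∈ openConn x z).card ≤ j} ≤
      (prodBernoulli w).real {ω : BondConfig (Fin n) | (∀ x ∈ S, ω ∉ openConn c x) ∧
          (A.filter fun z => ω ∈ openConn c z).card ≤ j} +
        (prodBernoulli w).real {ω : BondConfig (Fin n) | (∃ x ∈ S, ω ∈ openConn c x) ∧
          (A.filter fun z => ∃ x ∈ S, ω ∈ openConn x z).card ≤ j} := by
  set μ := prodBernoulli w with hμ
  set LS := {ω : BondConfig (Fin n) | (∀ x ∈ S, ω ∉ openConn c x) ∧
    1 ≤ (A.filter fun z => ∃ x ∈ S, ω ∈ openConn x z).card ∧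
    (A.filter fun z => ∃ x ∈ S, ω ∈ openConn x z).card ≤ j} with hLS
  set M := {ω : BondConfig (Fin n) | (∃ x ∈ S, ω ∈ openConn c x) ∧
    (A.filter fun z => ∃ x ∈ S, ω ∈ openConn x z).card ≤ j} with hM
  set B := {ω : BondConfig (Fin n) |
    1 ≤ (A.filter fun z => ∃ x ∈ S, ω ∈ openConn x z).card ∧
    (A.filter fun z => ∃ x ∈ S, ω ∈ openConn x z).card ≤ j} with hB
  have hBeq : B = LS ∪ M := by
    ext ω
    simp only [hB, hLS, hM, mem_setOf_eq, mem_union]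
    constructor
    · rintro ⟨h1, h2⟩
      by_cases hsep : ∀ x ∈ S, ω ∉ openConn c x
      · exact Or.inl ⟨hsep, h1, h2⟩
      · push Not at hsep
        obtain ⟨x, hx, hcx⟩ := hsep
        exact Or.inr ⟨⟨x, hx, hcx⟩, h2⟩
    · rintro (⟨_, h1, h2⟩ | ⟨⟨x, hx, hcx⟩, h2⟩)
      · exact ⟨h1, h2⟩
      · refine ⟨Finset.card_pos.2 ⟨c, Finset.mem_filter.2 ⟨hcA, x, hx, ?_⟩⟩, h2⟩
        exact SimpleGraph.Reachable.symm hcx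
  have hdisj : Disjoint LS M := by
    rw [Set.disjoint_left]
    rintro ω ⟨hsep, -, -⟩ ⟨⟨x, hx, hcx⟩, -⟩
    exact hsep x hx hcx
  have hBsum : μ.real B = μ.real LS + μ.real M := by
    rw [hBeq, measureReal_union hdisj MeasurableSet.of_discrete]
  rw [hBsum]
  constructor
  · intro h; linarith
  · intro h; linarith

/-- The glued lightness of `x` for a one-point set `{v}` is the plain lightness:
`μ(x ↮ v, |π(x)| ≤ j) + μ(x ↔ v, |π({v})| ≤ j) = μ{|π(x)| ≤ j}`. [folklore] -/
theorem glued_singleton (w : Sym2 (Fin n) → unitInterval) (A : Finset (Fin n)) (v x : Fin n) (j : ℕ) :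
    (prodBernoulli w).real {ω : BondConfig (Fin n) | (∀ y ∈ ({v} : Finset (Fin n)), ω ∉ openConn x y) ∧
          (A.filter fun z => ω ∈ openConn x z).card ≤ j} +
        (prodBernoulli w).real {ω : BondConfig (Fin n) | (∃ y ∈ ({v} : Finset (Fin n)), ω ∈ openConn x y) ∧
          (A.filter fun z => ∃ y ∈ ({v} : Finset (Fin n)), ω ∈ openConn y z).card ≤ j} =
      (prodBernoulli w).real {ω : BondConfig (Fin n) | (A.filter fun z => ω ∈ openConn x z).card ≤ j} := by
  set μ := prodBernoulli w with hμ
  set R := {ω : BondConfig (Fin n) | (A.filter fun z => ω ∈ openConn x z).card ≤ j} with hR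
  set V := (openConn x v : Set (BondConfig (Fin n))) with hV
  have h1 : {ω : BondConfig (Fin n) | (∀ y ∈ ({v} : Finset (Fin n)), ω ∉ openConn x y) ∧
      (A.filter fun z => ω ∈ openConn x z).card ≤ j} = R \ V := by
    ext ω
    simp only [hR, hV, mem_setOf_eq, mem_sdiff, Finset.mem_singleton, forall_eq]
    tauto
  have h2 : {ω : BondConfig (Fin n) | (∃ y ∈ ({v} : Finset (Fin n)), ω ∈ openConn x y) ∧
      (A.filter fun z => ∃ y ∈ ({v} : Finset (Fin n)), ω ∈ openConn y z).card ≤ j} = R ∩ V := by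
    ext ω
    have heq : (openGraph ω).Reachable x v →
        (A.filter fun z => ω ∈ openConn x z) =
          (A.filter fun z => ∃ y ∈ ({v} : Finset (Fin n)), ω ∈ openConn y z) := by
      intro hxv
      refine Finset.filter_congr fun z _ => ⟨fun h => ⟨v, Finset.mem_singleton_self v, hxv.symm.trans h⟩, ?_⟩
      rintro ⟨y, hy, h⟩
      rw [Finset.mem_singleton] at hy
      subst hy
      exact hxv.trans h
    constructor
    · rintro ⟨⟨y, hy, hxy⟩, hcard⟩
      rw [Finset.mem_singleton] at hy
      subst hy
      refine ⟨?_, hxy⟩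
      show (A.filter fun z => ω ∈ openConn x z).card ≤ j
      rw [heq hxy]; exact hcard
    · rintro ⟨hcard, hxv⟩
      refine ⟨⟨v, Finset.mem_singleton_self v, hxv⟩, ?_⟩
      rw [← heq hxv]; exact hcard
  rw [h1, h2, add_comm]
  exact measureReal_inter_add_sdiff (MeasurableSet.of_discrete (s := V)) (measure_ne_top _ _)

/-- A set `S` of non-relays with no positive pair leaving it carries no mass of `{1 ≤ |π(S)|}`: an open path from `S` to a
relay uses a pair leaving `S`, which has weight `0`. [folklore] -/
theorem setCS_of_isolated (w : Sym2 (Fin n) → unitInterval) (A S : Finset (Fin n)) (c : Fin n) (j : ℕ)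
    (hSA : Disjoint S A) (hiso : ∀ v ∈ S, ∀ y, y ∉ S → w s(v, y) = 0) :
    (prodBernoulli w).real {ω : BondConfig (Fin n) | (∀ x ∈ S, ω ∉ openConn c x) ∧
        1 ≤ (A.filter fun z => ∃ x ∈ S, ω ∈ openConn x z).card ∧
        (A.filter fun z => ∃ x ∈ S, ω ∈ openConn x z).card ≤ j} ≤
      (prodBernoulli w).real {ω : BondConfig (Fin n) | (∀ x ∈ S, ω ∉ openConn c x) ∧
        (A.filter fun z => ω ∈ openConn c z).card ≤ j} := by
  set μ := prodBernoulli w with hμ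
  set LS := {ω : BondConfig (Fin n) | (∀ x ∈ S, ω ∉ openConn c x) ∧
    1 ≤ (A.filter fun z => ∃ x ∈ S, ω ∈ openConn x z).card ∧
    (A.filter fun z => ∃ x ∈ S, ω ∈ openConn x z).card ≤ j} with hLS
  have hnull : LS ∩ {ω : BondConfig (Fin n) | ∀ e ∈ ω, w e ≠ 0} = ∅ := by
    ext ω
    simp only [hLS, mem_inter_iff, mem_setOf_eq, mem_empty_iff_false, iff_false, not_and]
    intro hω hsupp
    obtain ⟨z, hz⟩ := Finset.card_pos.1 (lt_of_lt_of_le Nat.zero_lt_one hω.2.1)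
    rw [Finset.mem_filter] at hz
    obtain ⟨x, hxS, hxz⟩ := hz.2
    have hzS : z ∉ S := fun h => Finset.disjoint_left.1 hSA h hz.1
    obtain ⟨p⟩ := (hxz : (openGraph ω).Reachable x z)
    obtain ⟨d, -, hd1, hd2⟩ := p.exists_boundary_dart (↑S : Set (Fin n)) (Finset.mem_coe.2 hxS)
      (fun h => hzS (Finset.mem_coe.1 h))
    have hadj := d.adj
    rw [openGraph_adj] at hadj
    exact hsupp _ hadj.1 (hiso d.fst (Finset.mem_coe.1 hd1) d.snd (fun h => hd2 (Finset.mem_coe.2 h)))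
  have h0 : μ.real LS = 0 := by
    rw [← measureReal_inter_support w LS, hnull, measureReal_empty]
  rw [h0]; exact measureReal_nonneg

end CutObserver

open CutObserver in
/-- **(ML) ⇒ set-champion stability (induction on the number of positive pairs).**  Assume the champion-shift condition
`hML` (see the file header).  Then for every weight function `w` on `Fin n`, every finite set `S` of non-relays and every
champion `c` (`c ∈ A`, `I_w(a) ≤ I_w(c)` for `a ∈ A`): `μ_w(c ↮ S, 1 ≤ |π(S)| ≤ j) ≤ μ_w(c ↮ S, |π(c)| ≤ j)`.
The statement is proved for all `w` whose number of positive pairs is at most `m`, by induction on `m`. [folklore] -/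
theorem setCS_of_ML (A : Finset (Fin n)) (j : ℕ)
    (hML : ∀ (w : Sym2 (Fin n) → unitInterval) (S : Finset (Fin n)) (c : Fin n),
      Disjoint S A → 2 ≤ S.card → c ∈ A →
      (∀ a ∈ A, (prodBernoulli w).real {ω : BondConfig (Fin n) | (A.filter fun z => ω ∈ openConn a z).card ≤ j} ≤
        (prodBernoulli w).real {ω : BondConfig (Fin n) | (A.filter fun z => ω ∈ openConn c z).card ≤ j}) →
      (∀ v ∈ S, (prodBernoulli w).real {ω : BondConfig (Fin n) | (A.filter fun z => ω ∈ openConn c z).card ≤ j} <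
        (prodBernoulli w).real {ω : BondConfig (Fin n) | (A.filter fun z => ω ∈ openConn v z).card ≤ j}) →
      (∃ v ∈ S, ∃ y, y ∉ S ∧ w s(v, y) ≠ 0) →
      ∃ F : Finset (Sym2 (Fin n)), F.Nonempty ∧ (∀ e ∈ F, w e ≠ 0 ∧ ∃ v ∈ S, ∃ y, y ≠ v ∧ e = s(v, y)) ∧
        ∃ cF ∈ A,
          (∀ a ∈ A,
            (prodBernoulli (fun e => if e ∈ F then 0 else w e)).real
                {ω : BondConfig (Fin n) | (A.filter fun z => ω ∈ openConn a z).card ≤ j} ≤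
              (prodBernoulli (fun e => if e ∈ F then 0 else w e)).real
                {ω : BondConfig (Fin n) | (A.filter fun z => ω ∈ openConn cF z).card ≤ j}) ∧
          (prodBernoulli w).real {ω : BondConfig (Fin n) | (∀ y ∈ S, ω ∉ openConn cF y) ∧
                (A.filter fun z => ω ∈ openConn cF z).card ≤ j} +
              (prodBernoulli w).real {ω : BondConfig (Fin n) | (∃ y ∈ S, ω ∈ openConn cF y) ∧
                (A.filter fun z => ∃ y ∈ S, ω ∈ openConn y z).card ≤ j} ≤
            (prodBernoulli w).real {ω : BondConfig (Fin n) | (∀ y ∈ S, ω ∉ openConn c y) ∧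
                (A.filter fun z => ω ∈ openConn c z).card ≤ j} +
              (prodBernoulli w).real {ω : BondConfig (Fin n) | (∃ y ∈ S, ω ∈ openConn c y) ∧
                (A.filter fun z => ∃ y ∈ S, ω ∈ openConn y z).card ≤ j})
    (m : ℕ) :
    ∀ (w : Sym2 (Fin n) → unitInterval), (Finset.univ.filter fun e => w e ≠ 0).card ≤ m →
      ∀ (S : Finset (Fin n)) (c : Fin n), Disjoint S A → S.Nonempty → c ∈ A →
      (∀ a ∈ A, (prodBernoulli w).real {ω : BondConfig (Fin n) | (A.filter fun z => ω ∈ openConn a z).card ≤ j} ≤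
        (prodBernoulli w).real {ω : BondConfig (Fin n) | (A.filter fun z => ω ∈ openConn c z).card ≤ j}) →
      (prodBernoulli w).real {ω : BondConfig (Fin n) | (∀ x ∈ S, ω ∉ openConn c x) ∧
          1 ≤ (A.filter fun z => ∃ x ∈ S, ω ∈ openConn x z).card ∧
          (A.filter fun z => ∃ x ∈ S, ω ∈ openConn x z).card ≤ j} ≤
        (prodBernoulli w).real {ω : BondConfig (Fin n) | (∀ x ∈ S, ω ∉ openConn c x) ∧
          (A.filter fun z => ω ∈ openConn c z).card ≤ j} := by
  induction m with
  | zero =>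
    intro w hcard S c hSA _ _ _
    -- no positive pair at all
    have hw0 : ∀ e, w e = 0 := by
      intro e
      by_contra hne
      have : e ∈ Finset.univ.filter fun e => w e ≠ 0 := Finset.mem_filter.2 ⟨Finset.mem_univ _, hne⟩
      rw [Finset.card_eq_zero.1 (Nat.le_zero.1 hcard)] at this
      exact absurd this (Finset.notMem_empty _)
    exact setCS_of_isolated w A S c j hSA fun v _ y _ => hw0 _
  | succ m ih =>
    intro w hcard S c hSA hSne hcA hchamp
    -- (i) a member of `S` no lighter than `c`: lonely-cluster exchange
    by_cases hheavy : ∃ y ∈ S,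
        (prodBernoulli w).real {ω : BondConfig (Fin n) | (A.filter fun z => ω ∈ openConn y z).card ≤ j} ≤
          (prodBernoulli w).real {ω : BondConfig (Fin n) | (A.filter fun z => ω ∈ openConn c z).card ≤ j}
    · obtain ⟨y, hyS, hy⟩ := hheavy
      convert observerSet_le_of_lonelier w A S y c hyS j hy using 12
    push Not at hheavy
    -- (ii) no positive pair leaving `S`
    by_cases hiso : ∀ v ∈ S, ∀ y, y ∉ S → w s(v, y) = 0
    · exact setCS_of_isolated w A S c j hSA hiso
    push Not at hiso
    obtain ⟨v₀, hv₀S, y₀, hy₀S, hwy₀⟩ := hiso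
    -- (iii) light `S` with a positive pair leaving it: get `F` and the shifted witness `cF`
    have key : ∃ F : Finset (Sym2 (Fin n)), F.Nonempty ∧ (∀ e ∈ F, w e ≠ 0 ∧ ∃ v ∈ S, ∃ y, y ≠ v ∧ e = s(v, y)) ∧
        ∃ cF ∈ A,
          (∀ a ∈ A,
            (prodBernoulli (fun e => if e ∈ F then 0 else w e)).real
                {ω : BondConfig (Fin n) | (A.filter fun z => ω ∈ openConn a z).card ≤ j} ≤
              (prodBernoulli (fun e => if e ∈ F then 0 else w e)).real
                {ω : BondConfig (Fin n) | (A.filter fun z => ω ∈ openConn cF z).card ≤ j}) ∧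
          (prodBernoulli w).real {ω : BondConfig (Fin n) | (∀ y ∈ S, ω ∉ openConn cF y) ∧
                (A.filter fun z => ω ∈ openConn cF z).card ≤ j} +
              (prodBernoulli w).real {ω : BondConfig (Fin n) | (∃ y ∈ S, ω ∈ openConn cF y) ∧
                (A.filter fun z => ∃ y ∈ S, ω ∈ openConn y z).card ≤ j} ≤
            (prodBernoulli w).real {ω : BondConfig (Fin n) | (∀ y ∈ S, ω ∉ openConn c y) ∧
                (A.filter fun z => ω ∈ openConn c z).card ≤ j} +
              (prodBernoulli w).real {ω : BondConfig (Fin n) | (∃ y ∈ S, ω ∈ openConn c y) ∧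
                (A.filter fun z => ∃ y ∈ S, ω ∈ openConn y z).card ≤ j} := by
      by_cases h2 : 2 ≤ S.card
      · exact hML w S c hSA h2 hcA hchamp hheavy ⟨v₀, hv₀S, y₀, hy₀S, hwy₀⟩
      · -- `S = {v₀}`: switch off ALL positive pairs at `v₀`, take any champion of the result
        have hS1 : S = {v₀} := by
          have hc1 : S.card = 1 := by
            have := Finset.card_pos.2 hSne; omega
          obtain ⟨x, hx⟩ := Finset.card_eq_one.1 hc1
          rw [hx] at hv₀S; rw [Finset.mem_singleton.1 hv₀S]; exact hx
        set F : Finset (Sym2 (Fin n)) :=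
          Finset.univ.filter fun e => w e ≠ 0 ∧ ∃ y, y ≠ v₀ ∧ e = s(v₀, y) with hF
        have hy₀v₀ : y₀ ≠ v₀ := fun h => hy₀S (h ▸ hv₀S)
        have hFne : F.Nonempty :=
          ⟨s(v₀, y₀), Finset.mem_filter.2 ⟨Finset.mem_univ _, hwy₀, y₀, hy₀v₀, rfl⟩⟩
        have hFmem : ∀ e ∈ F, w e ≠ 0 ∧ ∃ v ∈ S, ∃ y, y ≠ v ∧ e = s(v, y) := by
          intro e he
          obtain ⟨-, hwe, y, hy, rfl⟩ := Finset.mem_filter.1 he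
          exact ⟨hwe, v₀, hv₀S, y, hy, rfl⟩
        have hAne : A.Nonempty := ⟨c, hcA⟩
        obtain ⟨cF, hcFA, hcFmax⟩ := Finset.exists_max_image A
          (fun a => (prodBernoulli (fun e => if e ∈ F then 0 else w e)).real
            {ω : BondConfig (Fin n) | (A.filter fun z => ω ∈ openConn a z).card ≤ j}) hAne
        refine ⟨F, hFne, hFmem, cF, hcFA, hcFmax, ?_⟩
        rw [hS1, glued_singleton, glued_singleton]
        exact hchamp cF hcFA
    obtain ⟨F, hFne, hFmem, cF, hcFA, hcFchamp, hshift⟩ := key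
    -- the graph with `F` switched off has fewer positive pairs
    set wF : Sym2 (Fin n) → unitInterval := fun e => if e ∈ F then 0 else w e with hwF
    have hsub : (Finset.univ.filter fun e => wF e ≠ 0) ⊆ (Finset.univ.filter fun e => w e ≠ 0) \ F := by
      intro e he
      rw [Finset.mem_filter] at he
      rw [Finset.mem_sdiff, Finset.mem_filter]
      by_cases heF : e ∈ F
      · simp [hwF, heF] at he
      · simp only [hwF, heF, if_false] at he
        exact ⟨⟨Finset.mem_univ _, he.2⟩, heF⟩
    have hFsub : F ⊆ Finset.univ.filter fun e => w e ≠ 0 :=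
      fun e he => Finset.mem_filter.2 ⟨Finset.mem_univ _, (hFmem e he).1⟩
    have hcardF : (Finset.univ.filter fun e => wF e ≠ 0).card ≤ m := by
      have h1 := Finset.card_le_card hsub
      rw [Finset.card_sdiff_of_subset hFsub] at h1
      have h2 := Finset.card_pos.2 hFne
      omega
    -- `CS_w(S, cF)` by edge raising from `wF`
    have hcFS : cF ∉ S := fun h => Finset.disjoint_left.1 hSA h hcFA
    have hFshape : ∀ e ∈ F, ∃ v ∈ S, ∃ y, y ≠ v ∧ e = s(v, y) := fun e he => (hFmem e he).2
    have hbase : ∀ T : Finset (Fin n), S ⊆ T → cF ∉ T →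
        (prodBernoulli wF).real {ω : BondConfig (Fin n) |
            (∀ x ∈ T, ω ∉ openConn cF x) ∧ 1 ≤ (A.filter fun z => ∃ x ∈ T, ω ∈ openConn x z).card ∧
            (A.filter fun z => ∃ x ∈ T, ω ∈ openConn x z).card ≤ j} ≤
          (prodBernoulli wF).real {ω : BondConfig (Fin n) |
            (∀ x ∈ T, ω ∉ openConn cF x) ∧ (A.filter fun z => ω ∈ openConn cF z).card ≤ j} := by
      intro T hST hcFT
      by_cases hTA : Disjoint T A
      · exact ih wF hcardF T cF hTA (hSne.mono hST) hcFA hcFchamp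
      · -- `T` contains a relay `a`: lonely-cluster exchange with `a` (no lighter than the champion `cF` of `wF`)
        rw [Finset.not_disjoint_iff] at hTA
        obtain ⟨a, haT, haA⟩ := hTA
        convert observerSet_le_of_lonelier wF A T a cF haT j (hcFchamp a haA) using 12
    have hCSF := setCS_of_subgraph A S cF j hcFS F hFshape w hbase S (Finset.Subset.refl _) hcFS
    -- shift the witness from `cF` to `c`
    rw [bad_le_glued_iff_setCS w A S c j hcA]
    rw [bad_le_glued_iff_setCS w A S cF j hcFA] at hCSF
    exact hCSF.trans hshift

open CutObserver in
/-- **(ML) ⇒ the cumulative isolation lemma** (`stub_cumulativeIsolation` of the crux `NoHeavyLowerTail`,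
stmt-CriticalPhenomena-4575): for every weighted graph, every nonempty relay set `A`, every observer `o ∉ A` and every level
`j`, some relay `a` has `μ{1 ≤ N ≤ j} ≤ μ{|π(a)| ≤ j}` — namely any champion, by `setCS_of_ML` at `S = {o}` and
`cil_of_setCS_singleton`. [folklore] -/
theorem cumulativeIsolation_of_ML
    (hML : ∀ (n : ℕ) (w : Sym2 (Fin n) → unitInterval) (A S : Finset (Fin n)) (c : Fin n) (j : ℕ),
      Disjoint S A → 2 ≤ S.card → c ∈ A →
      (∀ a ∈ A, (prodBernoulli w).real {ω : BondConfig (Fin n) | (A.filter fun z => ω ∈ openConn a z).card ≤ j} ≤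
        (prodBernoulli w).real {ω : BondConfig (Fin n) | (A.filter fun z => ω ∈ openConn c z).card ≤ j}) →
      (∀ v ∈ S, (prodBernoulli w).real {ω : BondConfig (Fin n) | (A.filter fun z => ω ∈ openConn c z).card ≤ j} <
        (prodBernoulli w).real {ω : BondConfig (Fin n) | (A.filter fun z => ω ∈ openConn v z).card ≤ j}) →
      (∃ v ∈ S, ∃ y, y ∉ S ∧ w s(v, y) ≠ 0) →
      ∃ F : Finset (Sym2 (Fin n)), F.Nonempty ∧ (∀ e ∈ F, w e ≠ 0 ∧ ∃ v ∈ S, ∃ y, y ≠ v ∧ e = s(v, y)) ∧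
        ∃ cF ∈ A,
          (∀ a ∈ A,
            (prodBernoulli (fun e => if e ∈ F then 0 else w e)).real
                {ω : BondConfig (Fin n) | (A.filter fun z => ω ∈ openConn a z).card ≤ j} ≤
              (prodBernoulli (fun e => if e ∈ F then 0 else w e)).real
                {ω : BondConfig (Fin n) | (A.filter fun z => ω ∈ openConn cF z).card ≤ j}) ∧
          (prodBernoulli w).real {ω : BondConfig (Fin n) | (∀ y ∈ S, ω ∉ openConn cF y) ∧
                (A.filter fun z => ω ∈ openConn cF z).card ≤ j} +
              (prodBernoulli w).real {ω : BondConfig (Fin n) | (∃ y ∈ S, ω ∈ openConn cF y) ∧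
                (A.filter fun z => ∃ y ∈ S, ω ∈ openConn y z).card ≤ j} ≤
            (prodBernoulli w).real {ω : BondConfig (Fin n) | (∀ y ∈ S, ω ∉ openConn c y) ∧
                (A.filter fun z => ω ∈ openConn c z).card ≤ j} +
              (prodBernoulli w).real {ω : BondConfig (Fin n) | (∃ y ∈ S, ω ∈ openConn c y) ∧
                (A.filter fun z => ∃ y ∈ S, ω ∈ openConn y z).card ≤ j})
    (n : ℕ) (w : Sym2 (Fin n) → unitInterval) (A : Finset (Fin n)) (o : Fin n) (j : ℕ)
    (hA : A.Nonempty) (hoA : o ∉ A) :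
    ∃ a ∈ A,
      (prodBernoulli w).real {ω : BondConfig (Fin n) |
          1 ≤ (A.filter fun x => ω ∈ openConn o x).card ∧ (A.filter fun x => ω ∈ openConn o x).card ≤ j} ≤
        (prodBernoulli w).real {ω : BondConfig (Fin n) | (A.filter fun x => ω ∈ openConn a x).card ≤ j} := by
  obtain ⟨c, hcA, hcmax⟩ := Finset.exists_max_image A
    (fun a => (prodBernoulli w).real {ω : BondConfig (Fin n) | (A.filter fun z => ω ∈ openConn a z).card ≤ j}) hA
  refine ⟨c, hcA, cil_of_setCS_singleton w A o c j ?_⟩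
  have hSA : Disjoint ({o} : Finset (Fin n)) A := by
    rw [Finset.disjoint_singleton_left]; exact hoA
  exact setCS_of_ML A j (fun w' S' c' => hML n w' A S' c' j) _ w le_rfl {o} c hSA (Finset.singleton_nonempty o)
    hcA hcmax

/-- **(ML) closes the crux**: the champion-shift condition implies `NoHeavyLowerTail`, through
`cumulativeIsolation_of_ML` and the landed `noHeavyLowerTail_of_stub_cumulativeIsolation`. -/
theorem noHeavyLowerTail_of_ML
    (hML : ∀ (n : ℕ) (w : Sym2 (Fin n) → unitInterval) (A S : Finset (Fin n)) (c : Fin n) (j : ℕ),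
      Disjoint S A → 2 ≤ S.card → c ∈ A →
      (∀ a ∈ A, (prodBernoulli w).real {ω : BondConfig (Fin n) | (A.filter fun z => ω ∈ openConn a z).card ≤ j} ≤
        (prodBernoulli w).real {ω : BondConfig (Fin n) | (A.filter fun z => ω ∈ openConn c z).card ≤ j}) →
      (∀ v ∈ S, (prodBernoulli w).real {ω : BondConfig (Fin n) | (A.filter fun z => ω ∈ openConn c z).card ≤ j} <
        (prodBernoulli w).real {ω : BondConfig (Fin n) | (A.filter fun z => ω ∈ openConn v z).card ≤ j}) →
      (∃ v ∈ S, ∃ y, y ∉ S ∧ w s(v, y) ≠ 0) →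
      ∃ F : Finset (Sym2 (Fin n)), F.Nonempty ∧ (∀ e ∈ F, w e ≠ 0 ∧ ∃ v ∈ S, ∃ y, y ≠ v ∧ e = s(v, y)) ∧
        ∃ cF ∈ A,
          (∀ a ∈ A,
            (prodBernoulli (fun e => if e ∈ F then 0 else w e)).real
                {ω : BondConfig (Fin n) | (A.filter fun z => ω ∈ openConn a z).card ≤ j} ≤
              (prodBernoulli (fun e => if e ∈ F then 0 else w e)).real
                {ω : BondConfig (Fin n) | (A.filter fun z => ω ∈ openConn cF z).card ≤ j}) ∧
          (prodBernoulli w).real {ω : BondConfig (Fin n) | (∀ y ∈ S, ω ∉ openConn cF y) ∧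
                (A.filter fun z => ω ∈ openConn cF z).card ≤ j} +
              (prodBernoulli w).real {ω : BondConfig (Fin n) | (∃ y ∈ S, ω ∈ openConn cF y) ∧
                (A.filter fun z => ∃ y ∈ S, ω ∈ openConn y z).card ≤ j} ≤
            (prodBernoulli w).real {ω : BondConfig (Fin n) | (∀ y ∈ S, ω ∉ openConn c y) ∧
                (A.filter fun z => ω ∈ openConn c z).card ≤ j} +
              (prodBernoulli w).real {ω : BondConfig (Fin n) | (∃ y ∈ S, ω ∈ openConn c y) ∧
                (A.filter fun z => ∃ y ∈ S, ω ∈ openConn y z).card ≤ j}) :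
    Summit.CriticalPhenomena.PercolationContinuityZ3.Theses.PercNearOneGluing.NoHeavyLowerTail :=
  noHeavyLowerTail_of_stub_cumulativeIsolation fun n w A o j hA hoA =>
    cumulativeIsolation_of_ML hML n w A o j hA hoA

end Summit.CriticalPhenomena.PercolationContinuityZ3.Theorems

end
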